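import Mathlib
import Summits.NavierStokesRegularity.FluidComputer.GadgetLedger
import Summits.NavierStokesRegularity.FluidComputer.AmplitudeLedger
import HarnessLib

/-!
# The `m`-children ledger, II: Kelvin and step-time cross-checks, the exponent `α_m` and its dictionary
# with the spec sheet (`Tmax n = τ_n`), the amplitude dictionary (`r`, `Dc_sup`), and the interface's floors

Cell `ns-blowup`, seat `ns-blowup-fc-prover-1` (D-0074 GROUP C, door N1-FC); companion of
`GadgetLedger.lean` (KILLSHEET §VI.3 FC-AUDIT). HONEST FRAMING: low prior, high value-of-information
experiment on Tao's machine paradigm (Tao 2016 §1.3); NOT a claim that NS blows up. WHAT THIS IS NOT: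
not Navier–Stokes — dimensional bookkeeping over the ledger; the only contact with a PDE is the last
section, which reads the tree's gadget interface `GadgetLibrary` (hypothesis fields `step`/`floor`,
never instantiated) through the ledger. No definitions; theorems only.

* CROSS-CHECKS recorded by the audit: the Kelvin winding-one ceiling `ω_{n+1} ≤ λ² ω_n` holds iff
  `η ≤ m/λ` (`packetVorticity_succ_le_iff`; so a cascade above the floor must BUNDLE vorticity at every
  step — KILLSHEET §VI.2 (e): "every Kelvin-respecting cascade that beats viscosity needs bundling");
  step times decrease iff `m/λ⁵ < η`, which the floor implies, and are then summable — finite horizon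
  (`turnover_succ_lt_iff`, `div_pow_five_lt_of_floor`, `summable_turnover`; audit item (iv)).
* THE EXPONENT FORM: `alphaEffChildren σ 1 = σ.alphaEff` (`alphaEffChildren_one`);
  `2 < alphaEffChildren σ m ↔ m/λ < η` (`two_lt_alphaEffChildren_iff`, the `m`-children version of
  `GadgetSpec.two_lt_alphaEff_iff`, "the one hard number of the spec sheet"); more children, slower
  clock (`alphaEffChildren_anti`); the ledger's step-time ratio is `λ^{-α_m}`
  (`inv_reynoldsRatio_mul_sq_eq_rpow`), so `τ_n = τ_0 (λⁿ)^{-α_m} = τ_0 (k_n/k_0)^{-α_m}`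
  (`turnover_eq_mul_rpow`) — the transfer-time law `T n ≤ Cplus (k n)^{-alpha}` of the spec sheet with
  equality: `Tmax_eq_turnover`.
* THE AMPLITUDE DICTIONARY (`AmplitudeLedger`, not restated — evaluated): on the amplitude sequence
  `packetSpeed σ m E0`, `levelRe = packetReynolds` (`levelRe_packetSpeed`, `rfl`), `ampGain = (ηλ/m)^{1/2} λ`,
  `reGain = reynoldsRatio σ m` (`reGain_packetSpeed`), `Dc_sup = 3 - log m / log λ`
  (`dcSup_packetSpeed`: `m` children = β-model active dimension `log m / log λ`, Frisch 1995 §8.5.1),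
  and the floor reads `1 ≤ r ↔ codim_star ≤ Dc_sup ↔ m/λ ≤ η`
  (`one_le_reGain_packetSpeed_iff`, `codimStar_le_dcSup_packetSpeed_iff`).
* THE INTERFACE READ THROUGH THE LEDGER (`m = 1`): along every Clay-class solution from the seed of a
  valid, closing `GadgetLibrary`, at the `n`-th checkpoint some point of the nest ball has squared speed
  `≥ cFloor · U_n²`, `U_n = packetSpeed σ 1 E0 n` (`packetSpeed_floor`), equivalently
  `‖u‖/(ν k_n) ≥ √cFloor · Re_n` (`packetReynolds_floor`): the ledger's speeds are, up to the constant
  `cFloor`, floors for the true flow — the chain `GadgetLibrary.no_global_regular_solution` runs to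
  infinity, and by `tendsto_packetReynolds_atTop_iff` (`m = 1`) the local Reynolds number at the nest
  is unbounded exactly when `λ⁻¹ < η`.

References: T. Tao, J. Amer. Math. Soc. 29 (2016) 601–674, §1.3 and Prop. 6.3 (machine paradigm;
lifespan law); U. Frisch, *Turbulence* (CUP 1995) §8.5.1 (β-model, `m = λ^D`). Folklore dimensional
analysis, summit-side. 0 sorry; axioms ⊆ {propext, Classical.choice, Quot.sound}.
-/

noncomputable section

open Filter
open scoped Topology

namespace Summit.NavierStokesRegularity.FluidComputer.GadgetLedger

open Literature.Analysis.FluidPDE Literature.Analysis.FluidPDE.FluidComputer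

variable {σ : GadgetSpec}

/-! ## Cross-checks recorded by the audit -/

/-- KELVIN (KILLSHEET §VI.2 (e)): the winding-one ceiling `ω_{n+1} ≤ λ² ω_n` holds iff `η ≤ m/λ`; so a
cascade above the floor exceeds it at every step (vorticity must be bundled). -/
theorem packetVorticity_succ_le_iff (hσ : σ.Valid) {m : ℕ} (hm : 0 < m) {E0 : ℝ} (hE0 : 0 < E0)
    (n : ℕ) :
    packetVorticity σ m E0 (n + 1) ≤ σ.s ^ 2 * packetVorticity σ m E0 n ↔ σ.eta ≤ (m : ℝ) / σ.s := by
  have hpos : 0 < σ.s ^ 2 * packetVorticity σ m E0 n :=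
    mul_pos (pow_pos (zero_lt_one.trans hσ.one_lt_s) 2) (packetVorticity_pos hσ hm hE0 n)
  rw [packetVorticity_succ hσ, mul_assoc, mul_le_iff_le_one_left hpos, ← not_lt,
    one_lt_reynoldsRatio_iff hσ hm, not_lt]

/-- KELVIN, strict form: `λ² ω_n < ω_{n+1} ↔ m/λ < η`. -/
theorem sq_mul_packetVorticity_lt_succ_iff (hσ : σ.Valid) {m : ℕ} (hm : 0 < m) {E0 : ℝ}
    (hE0 : 0 < E0) (n : ℕ) :
    σ.s ^ 2 * packetVorticity σ m E0 n < packetVorticity σ m E0 (n + 1) ↔ (m : ℝ) / σ.s < σ.eta := by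
  rw [← not_le, packetVorticity_succ_le_iff hσ hm hE0, not_le]

/-- STEP TIMES (audit item (iv)): `τ_{n+1} < τ_n ↔ m/λ⁵ < η`. -/
theorem turnover_succ_lt_iff (hσ : σ.Valid) {m : ℕ} (hm : 0 < m) {E0 : ℝ} (hE0 : 0 < E0) (n : ℕ) :
    turnover σ m E0 (n + 1) < turnover σ m E0 n ↔ (m : ℝ) / σ.s ^ 5 < σ.eta := by
  have hs : 0 < σ.s := zero_lt_one.trans hσ.one_lt_s
  have hm' : (0 : ℝ) < m := Nat.cast_pos.2 hm
  have hq : 0 < reynoldsRatio σ m * σ.s ^ 2 := mul_pos (reynoldsRatio_pos hσ hm) (pow_pos hs 2)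
  have hkey : 1 < reynoldsRatio σ m * σ.s ^ 2 ↔ (m : ℝ) / σ.s ^ 5 < σ.eta := by
    have hsq : reynoldsRatio σ m * σ.s ^ 2 = Real.sqrt (σ.eta * σ.s ^ 5 / m) := by
      unfold reynoldsRatio
      rw [show σ.eta * σ.s ^ 5 / m = σ.eta * σ.s / m * (σ.s ^ 2) ^ 2 by ring,
        Real.sqrt_mul' _ (sq_nonneg _), Real.sqrt_sq (sq_nonneg σ.s)]
    rw [hsq, Real.lt_sqrt zero_le_one, one_pow, one_lt_div hm', div_lt_iff₀ (pow_pos hs 5)]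
  rw [turnover_succ hσ hm hE0, div_lt_iff₀ hq, lt_mul_iff_one_lt_right (turnover_pos hσ hm hE0 n),
    hkey]

/-- The floor implies the step-time condition: `m/λ < η → m/λ⁵ < η` (`λ > 1`). -/
theorem div_pow_five_lt_of_floor (hσ : σ.Valid) {m : ℕ} (h : (m : ℝ) / σ.s < σ.eta) :
    (m : ℝ) / σ.s ^ 5 < σ.eta := by
  have hs : 0 < σ.s := zero_lt_one.trans hσ.one_lt_s
  refine lt_of_le_of_lt ?_ h
  exact div_le_div_of_nonneg_left (Nat.cast_nonneg m) hs
    (le_self_pow₀ hσ.one_lt_s.le (by norm_num))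

/-- STEP TIMES are summable under `m/λ⁵ < η` (geometric with ratio `< 1`); in particular above the
floor the cascade has a finite horizon. -/
theorem summable_turnover (hσ : σ.Valid) {m : ℕ} (hm : 0 < m) {E0 : ℝ} (hE0 : 0 < E0)
    (h : (m : ℝ) / σ.s ^ 5 < σ.eta) : Summable (turnover σ m E0) := by
  have hq : 0 < reynoldsRatio σ m * σ.s ^ 2 :=
    mul_pos (reynoldsRatio_pos hσ hm) (pow_pos (zero_lt_one.trans hσ.one_lt_s) 2)
  have hlt : turnover σ m E0 (0 + 1) < turnover σ m E0 0 := (turnover_succ_lt_iff hσ hm hE0 0).2 h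
  have hratio : (reynoldsRatio σ m * σ.s ^ 2)⁻¹ < 1 := by
    rw [turnover_succ hσ hm hE0, div_lt_iff₀ hq,
      lt_mul_iff_one_lt_right (turnover_pos hσ hm hE0 0)] at hlt
    exact inv_lt_one_of_one_lt₀ hlt
  have hfun : turnover σ m E0 = fun n => turnover σ m E0 0 * ((reynoldsRatio σ m * σ.s ^ 2)⁻¹) ^ n :=
    funext fun n => turnover_eq_mul_pow hσ hm hE0 n
  rw [hfun]
  exact (summable_geometric_of_lt_one (inv_pos.2 hq).le hratio).mul_left _

/-! ## The exponent form: `alphaEffChildren` -/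

/-- One child recovers the interface's exponent: `alphaEffChildren 1 = alphaEff`. -/
theorem alphaEffChildren_one : alphaEffChildren σ 1 = σ.alphaEff := by
  unfold alphaEffChildren GadgetSpec.alphaEff
  rw [Nat.cast_one]

/-- THE FLOOR in exponent form: `2 < alphaEffChildren m ↔ m/λ < η` (`λ > 1`, `η > 0`, `m ≥ 1`);
`m = 1` is `GadgetSpec.two_lt_alphaEff_iff`. -/
theorem two_lt_alphaEffChildren_iff (hσ : σ.Valid) {m : ℕ} (hm : 0 < m) :
    2 < alphaEffChildren σ m ↔ (m : ℝ) / σ.s < σ.eta := by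
  have hs0 : 0 < σ.s := zero_lt_one.trans hσ.one_lt_s
  have hm' : (0 : ℝ) < m := Nat.cast_pos.2 hm
  have hlog : 0 < Real.log σ.s := Real.log_pos hσ.one_lt_s
  have h1 : Real.log (m / σ.eta) < Real.log σ.s ↔ (m : ℝ) / σ.s < σ.eta := by
    rw [Real.log_lt_log_iff (div_pos hm' hσ.eta_pos) hs0, div_lt_iff₀ hσ.eta_pos,
      div_lt_iff₀ hs0, mul_comm]
  rw [← h1]
  unfold alphaEffChildren
  constructor
  · intro h
    have h2 : Real.log (m / σ.eta) / (2 * Real.log σ.s) < 1 / 2 := by linarith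
    rw [div_lt_iff₀ (by positivity)] at h2
    linarith
  · intro h
    have h2 : Real.log (m / σ.eta) / (2 * Real.log σ.s) < 1 / 2 := by
      rw [div_lt_iff₀ (by positivity)]; linarith
    linarith

/-- More children, slower clock: `alphaEffChildren` is antitone in `m`. -/
theorem alphaEffChildren_anti (hσ : σ.Valid) {m m' : ℕ} (hm : 0 < m) (hmm' : m ≤ m') :
    alphaEffChildren σ m' ≤ alphaEffChildren σ m := by
  have hm0 : (0 : ℝ) < m := Nat.cast_pos.2 hm
  have hlog : 0 < 2 * Real.log σ.s := by positivity [Real.log_pos hσ.one_lt_s]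
  have hle : Real.log (m / σ.eta) ≤ Real.log (m' / σ.eta) :=
    Real.log_le_log (div_pos hm0 hσ.eta_pos)
      (div_le_div_of_nonneg_right (Nat.cast_le.2 hmm') hσ.eta_pos.le)
  unfold alphaEffChildren
  have := div_le_div_of_nonneg_right hle hlog.le
  linarith

/-- The step-time ratio is a power of the scale ratio: `((ηλ/m)^{1/2} λ²)⁻¹ = λ^{-alphaEffChildren m}`.
-/
theorem inv_reynoldsRatio_mul_sq_eq_rpow (hσ : σ.Valid) {m : ℕ} (hm : 0 < m) :
    (reynoldsRatio σ m * σ.s ^ 2)⁻¹ = σ.s ^ (-alphaEffChildren σ m) := by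
  have hs0 : 0 < σ.s := zero_lt_one.trans hσ.one_lt_s
  have hm' : (0 : ℝ) < m := Nat.cast_pos.2 hm
  have hlog : Real.log σ.s ≠ 0 := (Real.log_pos hσ.one_lt_s).ne'
  have hq : 0 < reynoldsRatio σ m * σ.s ^ 2 := mul_pos (reynoldsRatio_pos hσ hm) (pow_pos hs0 2)
  have harg : 0 < σ.eta * σ.s / m := div_pos (mul_pos hσ.eta_pos hs0) hm'
  -- compare logarithms
  have hL : Real.log (reynoldsRatio σ m * σ.s ^ 2) = alphaEffChildren σ m * Real.log σ.s := by
    unfold reynoldsRatio alphaEffChildren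
    rw [Real.log_mul (Real.sqrt_pos.2 harg).ne' (pow_pos hs0 2).ne', Real.log_sqrt harg.le,
      Real.log_pow, Real.log_div (mul_pos hσ.eta_pos hs0).ne' hm'.ne',
      Real.log_mul hσ.eta_pos.ne' hs0.ne', Real.log_div hm'.ne' hσ.eta_pos.ne']
    field_simp
    ring
  rw [Real.rpow_neg hs0.le, Real.rpow_def_of_pos hs0, mul_comm (Real.log σ.s), ← hL,
    Real.exp_log hq]

/-- THE TRANSFER-TIME LAW the ledger produces: `τ_n = τ_0 · (λⁿ)^{-α}` with `α = alphaEffChildren m`,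
i.e. `τ_n = τ_0 (k_n/k_0)^{-α}` — the law `T n ≤ Cplus · (k n)^{-alpha}` of the spec sheet with equality.
-/
theorem turnover_eq_mul_rpow (hσ : σ.Valid) {m : ℕ} (hm : 0 < m) {E0 : ℝ} (hE0 : 0 < E0) (n : ℕ) :
    turnover σ m E0 n = turnover σ m E0 0 * (σ.s ^ n) ^ (-alphaEffChildren σ m) := by
  have hs : 0 ≤ σ.s := (zero_lt_one.trans hσ.one_lt_s).le
  rw [turnover_eq_mul_pow hσ hm hE0, inv_reynoldsRatio_mul_sq_eq_rpow hσ hm, Real.rpow_pow_comm hs]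

/-- Dictionary with the spec sheet: if `σ.alpha` is the ledger's exponent and `σ.Cplus · k0^{-alpha}` its
seed turnover time, then the spec's maximal transfer times ARE the ledger's turnover times,
`σ.Tmax n = τ_n`. -/
theorem Tmax_eq_turnover (hσ : σ.Valid) {m : ℕ} (hm : 0 < m) {E0 : ℝ} (hE0 : 0 < E0)
    (hα : σ.alpha = alphaEffChildren σ m) (hC : σ.Cplus * σ.k0 ^ (-σ.alpha) = turnover σ m E0 0)
    (n : ℕ) : σ.Tmax n = turnover σ m E0 n := by
  have hs : 0 ≤ σ.s := (zero_lt_one.trans hσ.one_lt_s).le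
  rw [GadgetSpec.Tmax_eq hσ, hC, turnover_eq_mul_rpow hσ hm hE0 n, hα, Real.rpow_pow_comm hs]

/-! ## The amplitude-side dictionary (`AmplitudeLedger`) read on the ledger -/

/-- The ledger's Reynolds numbers ARE the `AmplitudeLedger.levelRe` of the amplitude sequence
`packetSpeed σ m E0` on the wavenumber ladder `k0 λⁿ` (definitionally). -/
theorem levelRe_packetSpeed (ν : ℝ) (m : ℕ) (E0 : ℝ) (n : ℕ) :
    AmplitudeLedger.levelRe ν σ.k0 σ.s (packetSpeed σ m E0) n = packetReynolds σ m ν E0 n := rfl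

/-- The ledger's amplitude gain (`AmplitudeLedger.ampGain`, `g = U_{n+1}/U_n`) is `(ηλ/m)^{1/2} λ`
(`= (η λ³/m)^{1/2}`, `reynoldsRatio_mul_s`). -/
theorem ampGain_packetSpeed (hσ : σ.Valid) {m : ℕ} (hm : 0 < m) {E0 : ℝ} (hE0 : 0 < E0) (n : ℕ) :
    AmplitudeLedger.ampGain (packetSpeed σ m E0) n = reynoldsRatio σ m * σ.s := by
  unfold AmplitudeLedger.ampGain
  rw [packetSpeed_succ hσ, mul_div_cancel_right₀ _ (packetSpeed_pos hσ hm hE0 n).ne']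

/-- The ledger's level-Reynolds ratio (`AmplitudeLedger.reGain`, `r = g/λ`) is `reynoldsRatio σ m`. -/
theorem reGain_packetSpeed (hσ : σ.Valid) {m : ℕ} (hm : 0 < m) {E0 : ℝ} (hE0 : 0 < E0) (n : ℕ) :
    AmplitudeLedger.reGain σ.s (packetSpeed σ m E0) n = reynoldsRatio σ m := by
  unfold AmplitudeLedger.reGain
  rw [ampGain_packetSpeed hσ hm hE0, mul_div_cancel_right₀ _ (zero_lt_one.trans hσ.one_lt_s).ne']

/-- THE β-MODEL LINE: the one-step sup-norm concentration dimension `Dc_sup = 2 log (g/√η) / log λ`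
of `AmplitudeLedger` evaluates on the ledger to `3 - log m / log λ` — `m` children of size `λ⁻¹` form
an active set of dimension `log m / log λ`, i.e. concentration codimension `3 - log m / log λ`
(point-like for `m = 1`, tube-like for `m = λ`, sheet-like for `m = λ²`). -/
theorem dcSup_packetSpeed (hσ : σ.Valid) {m : ℕ} (hm : 0 < m) {E0 : ℝ} (hE0 : 0 < E0) (n : ℕ) :
    AmplitudeLedger.dcSup σ.s σ.eta (AmplitudeLedger.ampGain (packetSpeed σ m E0) n) =
      3 - Real.log m / Real.log σ.s := by
  have hs0 : 0 < σ.s := zero_lt_one.trans hσ.one_lt_s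
  have hm' : (0 : ℝ) < m := Nat.cast_pos.2 hm
  have hlog : Real.log σ.s ≠ 0 := (Real.log_pos hσ.one_lt_s).ne'
  have harg : 0 < σ.eta * σ.s ^ 3 / m := div_pos (mul_pos hσ.eta_pos (pow_pos hs0 3)) hm'
  rw [ampGain_packetSpeed hσ hm hE0,
    AmplitudeLedger.dcSup_eq hσ.eta_pos (mul_pos (reynoldsRatio_pos hσ hm) hs0),
    reynoldsRatio_mul_s hσ, Real.log_sqrt harg.le, Real.log_div (mul_pos hσ.eta_pos (pow_pos hs0 3)).ne'
      hm'.ne', Real.log_mul hσ.eta_pos.ne' (pow_pos hs0 3).ne', Real.log_pow]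
  field_simp
  ring

/-- THE FLOOR in the amplitude dictionary: the ledger's step has `r ≥ 1` iff `m/λ ≤ η`. -/
theorem one_le_reGain_packetSpeed_iff (hσ : σ.Valid) {m : ℕ} (hm : 0 < m) {E0 : ℝ} (hE0 : 0 < E0)
    (n : ℕ) : 1 ≤ AmplitudeLedger.reGain σ.s (packetSpeed σ m E0) n ↔ (m : ℝ) / σ.s ≤ σ.eta := by
  rw [reGain_packetSpeed hσ hm hE0, one_le_reynoldsRatio_iff hσ hm]

/-- … equivalently, by `AmplitudeLedger.one_le_reGain_iff_codimStar_le_dcSup` ("beats viscosity iff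
`Dc_sup ≥ codim_star`"): `codim_star (λ, η) ≤ Dc_sup` of the ledger's step iff `m/λ ≤ η`. -/
theorem codimStar_le_dcSup_packetSpeed_iff (hσ : σ.Valid) {m : ℕ} (hm : 0 < m) {E0 : ℝ}
    (hE0 : 0 < E0) (n : ℕ) :
    AmplitudeLedger.codimStar σ.s σ.eta ≤
        AmplitudeLedger.dcSup σ.s σ.eta (AmplitudeLedger.ampGain (packetSpeed σ m E0) n) ↔
      (m : ℝ) / σ.s ≤ σ.eta := by
  rw [← AmplitudeLedger.one_le_reGain_iff_codimStar_le_dcSup hσ.one_lt_s (packetSpeed_pos hσ hm hE0 n)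
      (packetSpeed_pos hσ hm hE0 (n + 1)) hσ.eta_pos,
    one_le_reGain_packetSpeed_iff hσ hm hE0]

/-! ## The interface read through the ledger (`m = 1`) -/

section Library

variable {ν : ℝ} (lib : GadgetLibrary ν σ)

/-- The squared one-child ledger speed at the library's certified seed energy is `k_n³ · E0 ηⁿ`.
-/
lemma packetSpeed_one_sq (hσ : σ.Valid) (n : ℕ) :
    packetSpeed σ 1 lib.E0 n ^ 2 = σ.k n ^ 3 * (lib.E0 * σ.eta ^ n) := by
  unfold packetSpeed packetEnergy
  rw [Nat.cast_one, div_one,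
    Real.sq_sqrt (mul_nonneg (pow_nonneg (GadgetSpec.k_pos hσ n).le 3)
      (mul_nonneg lib.E0_pos.le (pow_nonneg hσ.eta_pos.le n)))]

/-- **The ledger's speeds are floors for the true flow.** For a gadget library with valid, closing
specs, along EVERY Clay-class solution `(u, p)` of Navier–Stokes from the seed, at the `n`-th checkpoint
some point of the nest ball `B̄(0, R)` has squared speed at least `cFloor · U_n²`, `U_n` the one-child
ledger speed at seed energy `E0` (`GadgetLibrary.invariant` + the concentration field `floor`). This is
the chain `GadgetLibrary.no_global_regular_solution` runs to infinity. HONEST FRAMING: an implication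
from an interface nobody has instantiated; NOT a claim that NS blows up. -/
theorem packetSpeed_floor (hσ : σ.Valid) (hclos : σ.Closure) {u : ℝ → Vel} {p : ℝ → E3 → ℝ}
    (hu : IsSmoothOnHalfSpace u) (hp : IsSmoothOnHalfSpace p)
    (hsol : IsNavierStokesSolution ν 0 lib.seed u p) (hE : HasBoundedEnergy u) (n : ℕ) :
    ∃ x : E3, ‖x‖ ≤ lib.R ∧
      lib.cFloor * packetSpeed σ 1 lib.E0 n ^ 2 ≤ ‖u (lib.checkpoint n) x‖ ^ 2 := by
  obtain ⟨hx, hEn⟩ := lib.invariant hσ hclos hu hp hsol hE n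
  obtain ⟨x, hxR, hfloor⟩ := lib.floor n (u (lib.checkpoint n)) hx
  refine ⟨x, hxR, le_trans ?_ hfloor⟩
  rw [packetSpeed_one_sq lib hσ n, ← mul_assoc]
  exact mul_le_mul_of_nonneg_left hEn
    (mul_nonneg lib.cFloor_pos.le (pow_nonneg (GadgetSpec.k_pos hσ n).le 3))

/-- The same floor in Reynolds form: at the `n`-th checkpoint some point of the nest ball has
`‖u‖ / (ν k_n) ≥ √cFloor · Re_n`, `Re_n` the one-child ledger Reynolds number — which climbs to
infinity exactly when `λ⁻¹ < η` (`tendsto_packetReynolds_atTop_iff`, `m = 1`). -/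
theorem packetReynolds_floor (hσ : σ.Valid) (hclos : σ.Closure) (hν : 0 < ν) {u : ℝ → Vel}
    {p : ℝ → E3 → ℝ} (hu : IsSmoothOnHalfSpace u) (hp : IsSmoothOnHalfSpace p)
    (hsol : IsNavierStokesSolution ν 0 lib.seed u p) (hE : HasBoundedEnergy u) (n : ℕ) :
    ∃ x : E3, ‖x‖ ≤ lib.R ∧
      Real.sqrt lib.cFloor * packetReynolds σ 1 ν lib.E0 n ≤ ‖u (lib.checkpoint n) x‖ / (ν * σ.k n) := by
  obtain ⟨x, hxR, hsq⟩ := packetSpeed_floor lib hσ hclos hu hp hsol hE n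
  refine ⟨x, hxR, ?_⟩
  have hden : 0 < ν * σ.k n := mul_pos hν (GadgetSpec.k_pos hσ n)
  have hU : 0 ≤ packetSpeed σ 1 lib.E0 n := (packetSpeed_pos hσ one_pos lib.E0_pos n).le
  have hspeed : Real.sqrt lib.cFloor * packetSpeed σ 1 lib.E0 n ≤ ‖u (lib.checkpoint n) x‖ := by
    rw [← Real.sqrt_sq hU, ← Real.sqrt_mul lib.cFloor_pos.le, ← Real.sqrt_sq (norm_nonneg _)]
    exact Real.sqrt_le_sqrt hsq
  unfold packetReynolds
  rw [← mul_div_assoc]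
  exact div_le_div_of_nonneg_right hspeed hden.le

end Library

end Summit.NavierStokesRegularity.FluidComputer.GadgetLedger

end
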